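import Literature.Computability.AlgebraicComplexity.ASSS16LevelStep
import Literature.Computability.AlgebraicComplexity.ASSS16SparseLeafMinors
import HarnessLib

/-!
# [ASSS16] Cor. 4.3 AS PRINTED on the FSV occur-`k` formula model: the level step of the recursion
# — proofs only (val-lit p2 g3; N1 occur push, plan step F3/F4 junction)

M. Agrawal, C. Saha, R. Saptharishi, N. Saxena, *Jacobian hits circuits*, arXiv:1111.0582, §4
(held `paper:arxiv-1111.0582` p0010): "Let `𝒞_ℓ` denote the collection of sets for which we want to
construct a faithful map `Ψ_ℓ` at the `ℓ`-th level of the recursion. The collection `𝒞_{ℓ+1}` is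
formed from `𝒞_ℓ` using the above lemma [Lemma 4.2] … **Corollary 4.3.** If `Ψ_{ℓ+1}` is faithful to
`𝒞_{ℓ+1}` then `Ψ_ℓ : x_i ↦ (Σ_{j=1}^{r_ℓ} y_{j,ℓ} · (t_ℓ)^{ij}) + Ψ_{ℓ+1}(x_i)` is faithful to `𝒞_ℓ`"
(p0010:L34–L46). Bib key `AgrawalEtAl2011`.

This file assembles the corollary as ONE theorem `ASSS16.descentStep` — pure GLUE over the two
halves of record (val-lit lead-np RULING (38)): (a) the FACTOR half, val-lit t19's
`ASSS16.map_levelMinor_ne_zero_of_inv_succ` (`ASSS16LevelStep.lean`: Lemma 4.2's factorisation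
`(∏_j K_j^{e_j}) · V` of a level minor + faithfulness one level down keeps it non-zero), fed with a
non-zero Jacobian minor of transcendence-degree size (`exists_trdeg_jacobianMinor_ne_zero`, this
seat), and (b) the LAYOUT half, Lemma 2.2 in minor form over the FSV seed layout
(`descentFaithful`, this seat). In the cell's rendering a "level" is a `Fin`-indexed family of sub-formulas with
per-gate resource bounds (occur `≤ k`, size `≤ s`, depth `≤ d`) and derivative orders `≤ c`
(t19's design note in `ASSS16LevelRecursion.lean`); `𝒞_{ℓ+1}` = all such families one level down
with `≤ R'` members and orders `≤ c + 1`, together with the singletons of sub-formulas of depth `< d`.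

* `ASSS16.descentStep` — in the indexing of the keystone's invariant (block `j` = printed level
  `j + 2`; orders `≤ j`, family size `≤ r_{2+j} = (asssRec k t j).1`, depth `≤ D - 1 - j`): if
  `Ψ'` satisfies the invariant at `j + 1` (`j + 4 ≤ D`), then for every `j`-family `U` of `m ≤ r`
  members (`r` = seeds of block `j`, degrees `≤ dd`, `char 𝔽 = 0` or `> dd^r`) and every fresh
  block `emb : Fin r ⊕ Unit ↪ σ` untouched by `Ψ'`, `x_m ↦ block(m) + Ψ'(x_m)` is faithful to `U`
  — i.e. the invariant at `j` for `Ψ_j := block_j ⊕ Ψ_{j+1}`, one call per level.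

No definitions, no named facts. Honest framing: bookkeeping toward `FSV2018_thm48_topFanIn`
(t18's keystone does the induction over the blocks); `VP ≠ VNP` is NOT proved and nothing here
bears on it.

## References
* [AgrawalEtAl2011] arXiv:1111.0582 §4 Lemma 4.2 / Cor. 4.3, locator p0010.txt:L22–L46; §2
  Thm. 2.1 / Lemma 2.2, p0006.txt:L40–L60.
* [ForbesShpilkaVolk2018] Lemma 52, Prop. 17 / Fact 19 (the Vandermonde block `vdmGenCoeff`).
-/

noncomputable section

namespace Literature.Computability.AlgebraicComplexity

namespace ASSS16

open MvPolynomial Finset Literature.Barriers.ValiantsHypothesis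
open Literature.RepresentationTheory.AlgebraicGroups (iterPderiv)

variable {F : Type*} [Field F] {n : ℕ}

/-- **[ASSS16] Cor. 4.3 AS PRINTED (the level step), on the FSV occur-`k` formula model, in the
indexing of the keystone's invariant** (block `j` = printed level `j + 2`; `INV j` = "`Ψ_j` is
faithful, in Thm. 2.1 form, to every family `u ↦ Δ_{T u} (G u)` of `m ≤ r_{2+j}` derivatives of
order `≤ j` of sub-formulas with occur `≤ k`, size `≤ s`, depth `≤ D - 1 - j`"): if `Ψ'`
("`Ψ_{ℓ+1}`") satisfies `INV (j+1)` and `j + 4 ≤ D`, then for every `j`-family `U` with `m ≤ r`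
members (`r` = number of seeds of block `j`, degrees `≤ dd`, `char 𝔽 = 0` or `> dd^r`) and every
fresh injective block `emb : Fin r ⊕ Unit → σ` not touched by `Ψ'`, the lifted map
`Ψ : x_m ↦ Σ_{i<r} y_i t^{(i+1)·i_m} + Ψ'(x_m)` is faithful to `U`: `C(U) ≠ 0 ↔ C(Ψ(U)) ≠ 0`.
Proof = the printed one, as glue: a non-zero trdeg-size minor (`exists_trdeg_jacobianMinor_ne_zero`)
is kept non-zero by `Ψ'` (Lemma 4.2 + `INV (j+1)`: val-lit t19's
`map_levelMinor_ne_zero_of_inv_succ`), and Lemma 2.2 in minor form (`descentFaithful`) concludes.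
[cite: AgrawalEtAl2011, Cor. 4.3 with Lemma 4.2 and Lemma 2.2] locator: paper:arxiv-1111.0582 p0010.txt:L22–L46 -/
theorem descentStep {k t s D j m r dd : ℕ} {σ : Type*} (hj : j + 4 ≤ D)
    (Ψ' : MvPolynomial (multilinearMonomials n) F →ₐ[F] MvPolynomial σ F)
    (hINV : ∀ (m' : ℕ) (H : Fin m' → OccurFormula F (multilinearMonomials n))
        (T' : Fin m' → multilinearMonomials n →₀ ℕ), m' ≤ (asssRec k t (j + 1)).1 →
        (∀ u i, (H u).occur i ≤ k) → (∀ u, (H u).size ≤ s) →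
        (∀ u, (H u).depth ≤ D - 1 - (j + 1)) → (∀ u, (T' u).degree ≤ j + 1) →
        ∀ Q : MvPolynomial (Fin m') F,
          aeval (fun u => iterPderiv (A := F) (T' u) (H u).eval) Q ≠ 0 ↔
            aeval (fun u => Ψ' (iterPderiv (A := F) (T' u) (H u).eval)) Q ≠ 0)
    (G : Fin m → OccurFormula F (multilinearMonomials n)) (T : Fin m → multilinearMonomials n →₀ ℕ)
    (hm : m ≤ (asssRec k t j).1) (hk : ∀ u i, (G u).occur i ≤ k) (hs : ∀ u, (G u).size ≤ s)
    (hd : ∀ u, (G u).depth ≤ D - 1 - j) (hc : ∀ u, (T u).degree ≤ j) (hmr : m ≤ r)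
    (hdeg : ∀ u, (iterPderiv (A := F) (T u) (G u).eval).totalDegree ≤ dd)
    (hchar : ringChar F = 0 ∨ dd ^ r < ringChar F)
    (emb : Fin r ⊕ Unit → σ) (hemb : Function.Injective emb)
    (hfresh : ∀ mm : multilinearMonomials n, ∀ v ∈ (Ψ' (X mm)).vars, v ∉ Set.range emb)
    (C : MvPolynomial (Fin m) F) :
    aeval (fun u => iterPderiv (A := F) (T u) (G u).eval) C ≠ 0 ↔
      aeval (fun u => aeval (fun mm : multilinearMonomials n =>
        rename emb (vdmGenCoeff F n r (mm : Fin n →₀ ℕ)) + Ψ' (X mm))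
          (iterPderiv (A := F) (T u) (G u).eval)) C ≠ 0 := by
  classical
  haveI : Fintype (multilinearMonomials n) := Fintype.ofEquiv (Fin (2 ^ n)) (binaryOrder n)
  set U : Fin m → MvPolynomial (multilinearMonomials n) F :=
    fun u => iterPderiv (A := F) (T u) (G u).eval with hU
  have htr : TrdegLE F U r := trdegLE_fin_of_le U hmr
  -- a non-zero Jacobian minor of transcendence-degree size …
  obtain ⟨ρ, -, hρ, rows, cols, hinj, -, hdet⟩ :=
    exists_trdeg_jacobianMinor_ne_zero U hdeg htr hchar
  -- … kept non-zero by `Ψ'` (Lemma 4.2 + the invariant one level down: the factor half, t19) …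
  have hΨ : Ψ' (Matrix.of fun u v => pderiv (cols v) (U (rows u))).det ≠ 0 :=
    map_levelMinor_ne_zero_of_inv_succ hj Ψ' hINV G T hm hk hs hd hc rows hinj cols hdet
  -- … and Lemma 2.2 in minor form over the block layout (the layout half)
  exact descentFaithful U hdeg htr hchar Ψ' emb hemb hfresh hρ rows cols hΨ C

end ASSS16

end Literature.Computability.AlgebraicComplexity

end
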